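import Literature.LinearAlgebra.Matrix.HermitianFamilyBranches
import Mathlib.Analysis.Matrix.Spectrum
import Mathlib.LinearAlgebra.Complex.Module
import Mathlib.Topology.MetricSpace.Basic
import HarnessLib

/-!
# Crux `JmPairBridge` (stmt-HubbardSuperconductivity-2226), line `schur-rigid-bridge`:
# stub `stub_noSplitNearGeneric` — no eigenvalue splitting near a generic coupling

Route `JosephsonMirror`, crux `JmPairBridge`, line `schur-rigid-bridge`. The line selects a coupling
`U₀` at which the Hamiltonian pencil `u ↦ A u` has the MAXIMAL number of distinct eigenvalues and needs
the "no splitting" input: near such a coupling a continuous Hermitian family has exactly one eigenvalue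
near each eigenvalue of `A U₀`. This file proves that input, `stub_noSplitNearGeneric`, as glue around
the tree's labelled-neighbourhood theorem
`Literature.LinearAlgebra.Matrix.exists_isOpen_labelled` / `labelling_of_close`:

* `noSplit_card_toFinset_roots_charpoly` — the number of distinct roots of the characteristic
  polynomial of a Hermitian matrix is the number of its distinct eigenvalues (`eigFinset`), so the
  hypothesis "maximal number of distinct roots of `charpoly`" is the hypothesis `hmax` of
  `exists_isOpen_labelled`;
* `noSplit_exists_eigenvalues_eq` — an eigenvector equation `H ψ = μ ψ`, `ψ ≠ 0`, makes `μ` one of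
  the spectral-theorem eigenvalues `hH.eigenvalues k`;
* `stub_noSplitNearGeneric` — with `W, g` from `exists_isOpen_labelled`, a ball
  `|u - U₀| < ρ₁` inside `W` and `ρ := min ρ₁ (g / 4)`: for `|u - U₀| < ρ` two eigenvalues of `A u`
  within `ρ ≤ g / 4 < 2 (g / 4)` of the eigenvalue `μ₀` of `A U₀` are both the branch
  `branch (A u) μ₀` (last clause of `labelling_of_close`), hence equal.

Source: T. Kato, *Perturbation Theory for Linear Operators* (1966), Ch. II §§1.1, 5.2 (continuity
of the eigenvalues of a symmetric family; no splitting away from the exceptional points).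
No definitions, no named fact.
-/

noncomputable section

-- the mandated namespace `Summit.<Summit>.<Problem>.Theorems` repeats `HubbardSuperconductivity`
-- (single-problem summit), which the `dupNamespace` linter flags on every declaration
set_option linter.dupNamespace false

namespace Summit.HubbardSuperconductivity.HubbardSuperconductivity.Theorems.JosephsonMirror

open Matrix Literature.LinearAlgebra.Matrix

/-- The number of distinct roots of the characteristic polynomial of a Hermitian matrix is the
number of its distinct eigenvalues `#eigFinset`. [folklore] -/
theorem noSplit_card_toFinset_roots_charpoly {ι : Type*} [Fintype ι] [DecidableEq ι]
    {H : Matrix ι ι ℂ} (hH : H.IsHermitian) :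
    H.charpoly.roots.toFinset.card = (eigFinset hH).card := by
  unfold eigFinset
  rw [hH.roots_charpoly_eq_eigenvalues]
  change (Finset.univ.image (RCLike.ofReal ∘ hH.eigenvalues)).card = _
  rw [← Finset.image_image, Finset.card_image_of_injective _ RCLike.ofReal_injective]

/-- An eigenvector equation `H ψ = μ ψ` with `ψ ≠ 0` and real `μ` makes `μ` one of the
spectral-theorem eigenvalues of the Hermitian matrix `H`: `μ - H` is not injective, so `μ` lies in
the real spectrum, which is the range of `hH.eigenvalues`. [folklore] -/
theorem noSplit_exists_eigenvalues_eq {ι : Type*} [Fintype ι] [DecidableEq ι]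
    {H : Matrix ι ι ℂ} (hH : H.IsHermitian) {μ : ℝ} {ψ : ι → ℂ} (hψ0 : ψ ≠ 0)
    (hψ : H *ᵥ ψ = (μ : ℂ) • ψ) : ∃ k, hH.eigenvalues k = μ := by
  have hE : μ ∈ spectrum ℝ H := by
    rw [spectrum.mem_iff]
    intro hunit
    apply hψ0
    apply Matrix.mulVec_injective_iff_isUnit.2 hunit
    rw [mulVec_zero, sub_mulVec, hψ, Algebra.algebraMap_eq_smul_one, smul_mulVec, one_mulVec,
      Complex.coe_smul, sub_self]
  rwa [hH.spectrum_real_eq_range_eigenvalues] at hE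

/-- **STUB `stub_noSplitNearGeneric`** (no splitting near a generic point). For a continuous family
`A : ℝ → Matrix ι ι ℂ` of Hermitian matrices and a coupling `U₀` with the MAXIMAL number of distinct
eigenvalues, every eigenvalue `μ₀` of `A U₀` has a radius `ρ > 0` such that for `|u - U₀| < ρ` any two
eigenvalues of `A u` within `ρ` of `μ₀` coincide (the labelled neighbourhood of
`Literature.LinearAlgebra.Matrix.exists_isOpen_labelled` / `labelling_of_close`). Kato (1966) II §5.2.
[folklore] -/
theorem stub_noSplitNearGeneric {ι : Type*} [Fintype ι] [DecidableEq ι] (A : ℝ → Matrix ι ι ℂ)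
    (hA : ∀ u, (A u).IsHermitian) (hc : Continuous A) (U₀ : ℝ)
    (hgen : ∀ u' : ℝ, (A u').charpoly.roots.toFinset.card ≤ (A U₀).charpoly.roots.toFinset.card)
    (μ₀ : ℝ) (hμ₀ : ∃ ψ₀ : ι → ℂ, ψ₀ ≠ 0 ∧ A U₀ *ᵥ ψ₀ = (μ₀ : ℂ) • ψ₀) :
    ∃ ρ : ℝ, 0 < ρ ∧ ∀ u : ℝ, |u - U₀| < ρ →
      ∀ (μ₁ μ₂ : ℝ) (ψ₁ ψ₂ : ι → ℂ), ψ₁ ≠ 0 → A u *ᵥ ψ₁ = (μ₁ : ℂ) • ψ₁ →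
        ψ₂ ≠ 0 → A u *ᵥ ψ₂ = (μ₂ : ℂ) • ψ₂ → |μ₁ - μ₀| < ρ → |μ₂ - μ₀| < ρ → μ₁ = μ₂ := by
  -- maximality of the number of distinct eigenvalues at `U₀`, in the `eigFinset` form
  have hmax : ∀ u, (eigFinset (hA u)).card ≤ (eigFinset (hA U₀)).card := fun u => by
    rw [← noSplit_card_toFinset_roots_charpoly (hA u),
      ← noSplit_card_toFinset_roots_charpoly (hA U₀)]
    exact hgen u
  -- the labelled neighbourhood `W` of `U₀` and the gap `g` of the distinct eigenvalues of `A U₀`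
  obtain ⟨W, g, hWo, hU₀W, hg, hgap, hW, -⟩ := exists_isOpen_labelled hA hc U₀ hmax
  obtain ⟨ρ₁, hρ₁, hball⟩ := Metric.isOpen_iff.1 hWo U₀ hU₀W
  -- `μ₀` is one of the distinct eigenvalues of `A U₀`
  obtain ⟨ψ₀, hψ₀, hAψ₀⟩ := hμ₀
  have hμ₀S : μ₀ ∈ eigFinset (hA U₀) :=
    (mem_eigFinset_iff (hA U₀)).2 (noSplit_exists_eigenvalues_eq (hA U₀) hψ₀ hAψ₀)
  refine ⟨min ρ₁ (g / 4), lt_min hρ₁ (by positivity),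
    fun u hu μ₁ μ₂ ψ₁ ψ₂ hψ₁ hA₁ hψ₂ hA₂ h₁ h₂ => ?_⟩
  have huW : u ∈ W := by
    refine hball (Metric.mem_ball.2 ?_)
    rw [Real.dist_eq]
    exact hu.trans_le (min_le_left _ _)
  -- uniqueness clause of the pointwise labelling at `u`
  have hL := (labelling_of_close hA hg hgap (hW u huW) (hmax u)).2.2.2.2
  obtain ⟨k₁, hk₁⟩ := noSplit_exists_eigenvalues_eq (hA u) hψ₁ hA₁
  obtain ⟨k₂, hk₂⟩ := noSplit_exists_eigenvalues_eq (hA u) hψ₂ hA₂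
  have hg4 : min ρ₁ (g / 4) ≤ g / 4 := min_le_right _ _
  have h₁' : |(hA u).eigenvalues k₁ - μ₀| < 2 * (g / 4) := by rw [hk₁]; linarith
  have h₂' : |(hA u).eigenvalues k₂ - μ₀| < 2 * (g / 4) := by rw [hk₂]; linarith
  rw [← hk₁, ← hk₂, hL μ₀ hμ₀S k₁ h₁', hL μ₀ hμ₀S k₂ h₂']

end Summit.HubbardSuperconductivity.HubbardSuperconductivity.Theorems.JosephsonMirror

end
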